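import Summits.KontsevichZagierPeriods.KontsevichZagierPeriods.Theorems.RootDecompZetaThreeFrontierWordMatchPreludeP3

/-! # `RootDecompZetaThreeFrontierWordMatchPreludeP4` — part 4/5 of the mechanical ≤360-line split of `MatchPrelude.stripped.lean`
(split by the decomp-kz census seat for landing; mathematics unchanged; part 4 continues part 3). -/

noncomputable section
set_option linter.dupNamespace false

noncomputable section
set_option linter.dupNamespace false
open Set MeasureTheory MvPolynomial
open Literature.NumberTheory.Transcendental
open Summit.KontsevichZagierPeriods.KontsevichZagierPeriods.Theorems.RootDecompZetaThreeFrontierWordMoves (mem_simplex_three_iff)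

namespace Summit.KontsevichZagierPeriods.RootDecompZetaThreeFrontier.WordLayer

section LayerConv

/-- **the LAYER REPRESENTATION**: a layer class as an honest `KZ.IntegralRep 3` on `Δ₃` -/
def layerRep (P : MvPolynomial (Fin 3) ℚ) {β₀ β₁ γ₁ γ₂ α : ℕ} (hα : α ≤ 1) (hβ : β₁ ≤ 1) (hγ : γ₁ ≤ 1)
    (h0 : β₀ + β₁ + α ≤ 2) (h1 : γ₂ + γ₁ + α ≤ 2) : KZ.IntegralRep 3 :=
  ⟨KZ.openOrderedSimplex 3, layerF P β₀ β₁ γ₁ γ₂ α, KZ.isSemialgebraic_openOrderedSimplex 3, layerF_sa P β₀ β₁ γ₁ γ₂ α,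
    layer_integrableOn P hα hβ hγ h0 h1⟩

/-- Auxiliary step `layerRep_domain`. [bookkeeping] -/
theorem layerRep_domain (P : MvPolynomial (Fin 3) ℚ) {β₀ β₁ γ₁ γ₂ α : ℕ} (hα : α ≤ 1) (hβ : β₁ ≤ 1) (hγ : γ₁ ≤ 1)
    (h0 : β₀ + β₁ + α ≤ 2) (h1 : γ₂ + γ₁ + α ≤ 2) :
    (layerRep P hα hβ hγ h0 h1).domain = KZ.openOrderedSimplex 3 := rfl

/-- Auxiliary step `layerRep_integrand`. [bookkeeping] -/
theorem layerRep_integrand (P : MvPolynomial (Fin 3) ℚ) {β₀ β₁ γ₁ γ₂ α : ℕ} (hα : α ≤ 1) (hβ : β₁ ≤ 1) (hγ : γ₁ ≤ 1)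
    (h0 : β₀ + β₁ + α ≤ 2) (h1 : γ₂ + γ₁ + α ≤ 2) :
    (layerRep P hα hβ hγ h0 h1).integrand = layerF P β₀ β₁ γ₁ γ₂ α := rfl

/-! ## §26  THE GENERAL CONVERGENCE ENGINE: every ADMISSIBLE GAP CLASS is absolutely integrable on `Δ₃`
(sector criterion, sufficiency).  Localise by the vertex chart (V0, E1 become pure powers `≤ 1`), then route the three
far-corner factors `(1-y₀y₁)^{-α}`, `(1-y₂y₀)^{-γ₁}`, `(1-y₂y₀y₁)^{-γ₂}` onto `(1-y₀)^{κ₁}`, `(1-y₁)^{κ₂}`, `(1-y₂)^{κ₀}` by max/AM–GM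
with REAL weights (a 3-source transportation problem whose Hall conditions are exactly Ed, E2, V1; greedy routing). -/

/-! ### 26a  max/AM–GM with a natural exponent -/

/-- Auxiliary step `rpow_mul_rpow_le_max_rpow`. [bookkeeping] -/
theorem rpow_mul_rpow_le_max_rpow {x y a b : ℝ} (hx : 0 ≤ x) (hy : 0 ≤ y) (ha : 0 ≤ a) (hb : 0 ≤ b) :
    x ^ a * y ^ b ≤ (max x y) ^ (a + b) := by
  have hm : 0 ≤ max x y := hx.trans (le_max_left _ _)
  calc x ^ a * y ^ b ≤ (max x y) ^ a * (max x y) ^ b :=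
        mul_le_mul (Real.rpow_le_rpow hx (le_max_left _ _) ha) (Real.rpow_le_rpow hy (le_max_right _ _) hb)
          (Real.rpow_nonneg hy _) (Real.rpow_nonneg hm _)
    _ = (max x y) ^ (a + b) := by rw [← Real.rpow_add_of_nonneg hm ha hb]

/-- Auxiliary step `rpow3_le_max_rpow`. [bookkeeping] -/
theorem rpow3_le_max_rpow {x y z a b c : ℝ} (hx : 0 ≤ x) (hy : 0 ≤ y) (hz : 0 ≤ z) (ha : 0 ≤ a) (hb : 0 ≤ b) (hc : 0 ≤ c) :
    x ^ a * y ^ b * z ^ c ≤ (max (max x y) z) ^ (a + b + c) := by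
  set m := max (max x y) z with hm_def
  have hxm : x ≤ m := (le_max_left _ _).trans (le_max_left _ _)
  have hym : y ≤ m := (le_max_right _ _).trans (le_max_left _ _)
  have hzm : z ≤ m := le_max_right _ _
  have hm : 0 ≤ m := hx.trans hxm
  calc x ^ a * y ^ b * z ^ c ≤ m ^ a * m ^ b * m ^ c :=
        mul_le_mul (mul_le_mul (Real.rpow_le_rpow hx hxm ha) (Real.rpow_le_rpow hy hym hb) (Real.rpow_nonneg hy _)
          (Real.rpow_nonneg hm _)) (Real.rpow_le_rpow hz hzm hc) (Real.rpow_nonneg hz _)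
          (mul_nonneg (Real.rpow_nonneg hm _) (Real.rpow_nonneg hm _))
    _ = m ^ (a + b + c) := by
        rw [← Real.rpow_add_of_nonneg hm ha hb, ← Real.rpow_add_of_nonneg hm (add_nonneg ha hb) hc]

/-- `1/(1-uv)^n ≤ (1-u)^{-a}(1-v)^{-b}` for `u, v ∈ [0,1)`, `a, b ≥ 0`, `a+b = n` -/
theorem one_div_pow_le_rpow2 {u v a b : ℝ} {n : ℕ} (hu0 : 0 ≤ u) (hu1 : u < 1) (hv0 : 0 ≤ v) (hv1 : v < 1) (ha : 0 ≤ a)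
    (hb : 0 ≤ b) (hab : a + b = n) : 1 / (1 - u * v) ^ n ≤ (1 - u) ^ (-a) * (1 - v) ^ (-b) := by
  have hu' : 0 < 1 - u := by linarith
  have hv' : 0 < 1 - v := by linarith
  have hm0 : 0 ≤ max (1 - u) (1 - v) := hu'.le.trans (le_max_left _ _)
  have hmax : max (1 - u) (1 - v) ≤ 1 - u * v := max_le (by nlinarith) (by nlinarith)
  have hprod : (1 - u) ^ a * (1 - v) ^ b ≤ (1 - u * v) ^ n :=
    calc (1 - u) ^ a * (1 - v) ^ b ≤ (max (1 - u) (1 - v)) ^ (a + b) := rpow_mul_rpow_le_max_rpow hu'.le hv'.le ha hb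
      _ = (max (1 - u) (1 - v)) ^ n := by rw [hab, Real.rpow_natCast]
      _ ≤ (1 - u * v) ^ n := pow_le_pow_left₀ hm0 hmax n
  have hpos : 0 < (1 - u) ^ a * (1 - v) ^ b := mul_pos (Real.rpow_pos_of_pos hu' _) (Real.rpow_pos_of_pos hv' _)
  rw [Real.rpow_neg hu'.le, Real.rpow_neg hv'.le, ← mul_inv, ← one_div]
  exact one_div_le_one_div_of_le hpos hprod

/-- `1/(1-uvw)^n ≤ (1-u)^{-a}(1-v)^{-b}(1-w)^{-c}` for `u, v, w ∈ [0,1)`, `a, b, c ≥ 0`, `a+b+c = n` -/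
theorem one_div_pow_le_rpow3 {u v w a b c : ℝ} {n : ℕ} (hu0 : 0 ≤ u) (hu1 : u < 1) (hv0 : 0 ≤ v) (hv1 : v < 1)
    (hw0 : 0 ≤ w) (hw1 : w < 1) (ha : 0 ≤ a) (hb : 0 ≤ b) (hc : 0 ≤ c) (habc : a + b + c = n) :
    1 / (1 - u * v * w) ^ n ≤ (1 - u) ^ (-a) * (1 - v) ^ (-b) * (1 - w) ^ (-c) := by
  have hu' : 0 < 1 - u := by linarith
  have hv' : 0 < 1 - v := by linarith
  have hw' : 0 < 1 - w := by linarith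
  have huv : u * v ≤ 1 := by nlinarith
  have hm0 : 0 ≤ max (max (1 - u) (1 - v)) (1 - w) := hw'.le.trans (le_max_right _ _)
  have hmax : max (max (1 - u) (1 - v)) (1 - w) ≤ 1 - u * v * w :=
    max_le (max_le (by nlinarith [mul_nonneg hu0 hv0, mul_le_of_le_one_right hu0 (show v * w ≤ 1 by nlinarith)])
      (by nlinarith [mul_nonneg hu0 hv0, mul_nonneg (mul_nonneg hu0 hv0) hw0])) (by nlinarith [mul_nonneg hu0 hv0])
  have hprod : (1 - u) ^ a * (1 - v) ^ b * (1 - w) ^ c ≤ (1 - u * v * w) ^ n :=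
    calc (1 - u) ^ a * (1 - v) ^ b * (1 - w) ^ c ≤ (max (max (1 - u) (1 - v)) (1 - w)) ^ (a + b + c) :=
          rpow3_le_max_rpow hu'.le hv'.le hw'.le ha hb hc
      _ = (max (max (1 - u) (1 - v)) (1 - w)) ^ n := by rw [habc, Real.rpow_natCast]
      _ ≤ (1 - u * v * w) ^ n := pow_le_pow_left₀ hm0 hmax n
  have hpos : 0 < (1 - u) ^ a * (1 - v) ^ b * (1 - w) ^ c :=
    mul_pos (mul_pos (Real.rpow_pos_of_pos hu' _) (Real.rpow_pos_of_pos hv' _)) (Real.rpow_pos_of_pos hw' _)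
  rw [Real.rpow_neg hu'.le, Real.rpow_neg hv'.le, Real.rpow_neg hw'.le, ← mul_inv, ← mul_inv, ← one_div]
  exact one_div_le_one_div_of_le hpos hprod

/-! ### 26b  The routing lemma (greedy solution of the 3-source transportation problem) -/

/-- **routing**: under Ed, E2, V1 there are non-negative real weights splitting `α = a + a'`, `γ₁ = b + b'`, `γ₂ = c + c' + c''`
with loads `a + b' + c' < κ₁ + 1` (on `1-y₀`), `a' + c'' < κ₂ + 1` (on `1-y₁`), `b + c < κ₀ + 1` (on `1-y₂`). -/
theorem routing3 (κ0 κ1 κ2 α γ₁ γ₂ : ℕ) (hEd : α ≤ κ1 + κ2 + 1) (hE2 : γ₁ ≤ κ0 + κ1 + 1)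
    (hV1 : γ₂ + γ₁ + α ≤ κ0 + κ1 + κ2 + 2) :
    ∃ a a' b b' c c' c'' : ℝ, 0 ≤ a ∧ 0 ≤ a' ∧ 0 ≤ b ∧ 0 ≤ b' ∧ 0 ≤ c ∧ 0 ≤ c' ∧ 0 ≤ c'' ∧
      a + a' = α ∧ b + b' = γ₁ ∧ c + c' + c'' = γ₂ ∧
      a + b' + c' < κ1 + 1 ∧ a' + c'' < κ2 + 1 ∧ b + c < κ0 + 1 := by
  have hEd' : (α : ℝ) ≤ κ1 + κ2 + 1 := by exact_mod_cast hEd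
  have hE2' : (γ₁ : ℝ) ≤ κ0 + κ1 + 1 := by exact_mod_cast hE2
  have hV1' : (γ₂ : ℝ) + γ₁ + α ≤ κ0 + κ1 + κ2 + 2 := by exact_mod_cast hV1
  have hk0 : (0 : ℝ) ≤ κ0 := Nat.cast_nonneg _
  have hk1 : (0 : ℝ) ≤ κ1 := Nat.cast_nonneg _
  have hk2 : (0 : ℝ) ≤ κ2 := Nat.cast_nonneg _
  have hα : (0 : ℝ) ≤ α := Nat.cast_nonneg _
  have hγ₁ : (0 : ℝ) ≤ γ₁ := Nat.cast_nonneg _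
  have hγ₂ : (0 : ℝ) ≤ γ₂ := Nat.cast_nonneg _
  -- saturation levels `κ + 3/4` of the two special sinks; the universal sink `1-y₀` takes the rest (greedy routing)
  obtain ⟨A, hA1, hA2, hA⟩ : ∃ A : ℝ, A ≤ α ∧ A ≤ κ2 + 3/4 ∧ (A = α ∨ A = κ2 + 3/4) :=
    ⟨min (α : ℝ) (κ2 + 3/4), min_le_left _ _, min_le_right _ _, min_choice _ _⟩
  obtain ⟨B, hB1, hB2, hB⟩ : ∃ B : ℝ, B ≤ γ₁ ∧ B ≤ κ0 + 3/4 ∧ (B = γ₁ ∨ B = κ0 + 3/4) :=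
    ⟨min (γ₁ : ℝ) (κ0 + 3/4), min_le_left _ _, min_le_right _ _, min_choice _ _⟩
  obtain ⟨C, hC1, hC2, hC⟩ : ∃ C : ℝ, C ≤ γ₂ ∧ C ≤ κ0 + 3/4 - B ∧ (C = γ₂ ∨ C = κ0 + 3/4 - B) :=
    ⟨min (γ₂ : ℝ) (κ0 + 3/4 - B), min_le_left _ _, min_le_right _ _, min_choice _ _⟩
  obtain ⟨E, hE1, hE2, hE⟩ : ∃ E : ℝ, E ≤ γ₂ - C ∧ E ≤ κ2 + 3/4 - A ∧ (E = γ₂ - C ∨ E = κ2 + 3/4 - A) :=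
    ⟨min ((γ₂ : ℝ) - C) (κ2 + 3/4 - A), min_le_left _ _, min_le_right _ _, min_choice _ _⟩
  refine ⟨α - A, A, B, γ₁ - B, C, γ₂ - C - E, E, by linarith, ?_, ?_, by linarith, ?_, by linarith, ?_, by ring, by ring,
    by ring, ?_, by linarith, by linarith⟩
  · rcases hA with hA | hA <;> linarith
  · rcases hB with hB | hB <;> linarith
  · rcases hC with hC | hC <;> linarith
  · rcases hE with hE | hE <;> linarith
  · rcases hA with hA | hA <;> rcases hB with hB | hB <;> rcases hC with hC | hC <;> rcases hE with hE | hE <;> linarith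

/-! ### 26c  Gap classes and their vertex-chart form -/

/-- the GAP CLASS `g^κ/((123)^β₀ (23)^β₁ (01)^γ₁ (012)^γ₂ (12)^α)`, `g = (1-t₀, t₀-t₁, t₁-t₂, t₂)` -/
def gapF (κ : Fin 4 → ℕ) (β₀ β₁ γ₁ γ₂ α : ℕ) (t : Fin 3 → ℝ) : ℝ :=
  (1 - t 0) ^ κ 0 * (t 0 - t 1) ^ κ 1 * (t 1 - t 2) ^ κ 2 * t 2 ^ κ 3 /
    (t 0 ^ β₀ * t 1 ^ β₁ * (1 - t 1) ^ γ₁ * (1 - t 2) ^ γ₂ * (t 0 - t 2) ^ α)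

/-- the far-corner part of a gap class in the chart -/
def gapW (κ : Fin 4 → ℕ) (γ₁ γ₂ α : ℕ) (y : Fin 3 → ℝ) : ℝ :=
  y 1 ^ κ 3 * ((1 - y 2) ^ κ 0 * (1 - y 0) ^ κ 1 * (1 - y 1) ^ κ 2) /
    ((1 - y 0 * y 1) ^ α * (1 - y 2 * y 0) ^ γ₁ * (1 - y 2 * y 0 * y 1) ^ γ₂)

/-- Auxiliary step `cube_facts`. [bookkeeping] -/
theorem cube_facts {y : Fin 3 → ℝ} (hy : y ∈ Cube3) :
    0 < 1 - y 0 ∧ 0 < 1 - y 1 ∧ 0 < 1 - y 2 ∧ 0 < 1 - y 0 * y 1 ∧ 0 < 1 - y 2 * y 0 ∧ 0 < 1 - y 2 * y 0 * y 1 := by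
  obtain ⟨h0, h01, h1, h11, h2, h21⟩ := hy
  refine ⟨by linarith, by linarith, by linarith, by nlinarith, by nlinarith, by nlinarith [mul_pos h2 h0]⟩

/-- the chart identity, cleared of the V0/E1 powers:
`y₂^{β₀+β₁+α} y₀^{β₁} · (y₂²y₀ · gapF(Ψ₃ y)) = y₂^{κ₁+κ₂+κ₃+2} y₀^{κ₂+κ₃+1} · gapW(y)` -/
theorem gapF_chart_mul (κ : Fin 4 → ℕ) (β₀ β₁ γ₁ γ₂ α : ℕ) {y : Fin 3 → ℝ} (hy : y ∈ Cube3) :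
    y 2 ^ (β₀ + β₁ + α) * y 0 ^ β₁ * (y 2 ^ 2 * y 0 * gapF κ β₀ β₁ γ₁ γ₂ α (vΨ y)) =
      y 2 ^ (κ 1 + κ 2 + κ 3 + 2) * y 0 ^ (κ 2 + κ 3 + 1) * gapW κ γ₁ γ₂ α y := by
  obtain ⟨h0, h01, h1, h11, h2, h21⟩ := hy
  obtain ⟨u0, u1, u2, p01, p20, p201⟩ := cube_facts ⟨h0, h01, h1, h11, h2, h21⟩
  have hy0 : y 0 ≠ 0 := h0.ne'
  have hy1 : y 1 ≠ 0 := h1.ne'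
  have hy2 : y 2 ≠ 0 := h2.ne'
  rw [gapF, gapW, vΨ_zero, vΨ_one, vΨ_two]
  have f1 : y 2 - y 2 * y 0 = y 2 * (1 - y 0) := by ring
  have f2 : y 2 * y 0 - y 2 * y 0 * y 1 = y 2 * y 0 * (1 - y 1) := by ring
  have f3 : y 2 - y 2 * y 0 * y 1 = y 2 * (1 - y 0 * y 1) := by ring
  rw [f1, f2, f3]
  simp only [mul_pow, mul_div_assoc']
  rw [div_eq_div_iff (by positivity) (by positivity)]
  ring

/-- Auxiliary step `gapW_nonneg`. [bookkeeping] -/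
theorem gapW_nonneg (κ : Fin 4 → ℕ) (γ₁ γ₂ α : ℕ) {y : Fin 3 → ℝ} (hy : y ∈ Cube3) : 0 ≤ gapW κ γ₁ γ₂ α y := by
  obtain ⟨u0, u1, u2, p01, p20, p201⟩ := cube_facts hy
  have h1 := hy.2.2.1
  unfold gapW
  positivity

/-- in the chart an admissible (V0, E1) gap class is dominated by its far-corner part -/
theorem gapF_chart_le (κ : Fin 4 → ℕ) {β₀ β₁ γ₁ γ₂ α : ℕ} (hV0 : β₀ + β₁ + α ≤ κ 1 + κ 2 + κ 3 + 2)
    (hE1 : β₁ ≤ κ 2 + κ 3 + 1) {y : Fin 3 → ℝ} (hy : y ∈ Cube3) :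
    y 2 ^ 2 * y 0 * gapF κ β₀ β₁ γ₁ γ₂ α (vΨ y) ≤ gapW κ γ₁ γ₂ α y := by
  obtain ⟨h0, h01, h1, h11, h2, h21⟩ := hy
  have hW := gapW_nonneg κ γ₁ γ₂ α ⟨h0, h01, h1, h11, h2, h21⟩
  have hP : 0 < y 2 ^ (β₀ + β₁ + α) * y 0 ^ β₁ := by positivity
  have key := gapF_chart_mul κ β₀ β₁ γ₁ γ₂ α ⟨h0, h01, h1, h11, h2, h21⟩
  refine le_of_mul_le_mul_left ?_ hP
  rw [key]
  exact mul_le_mul_of_nonneg_right (mul_le_mul (pow_le_pow_of_le_one h2.le h21.le hV0)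
    (pow_le_pow_of_le_one h0.le h01.le hE1) (by positivity) (by positivity)) hW

/-- Auxiliary step `gapF_chart_nonneg`. [bookkeeping] -/
theorem gapF_chart_nonneg (κ : Fin 4 → ℕ) (β₀ β₁ γ₁ γ₂ α : ℕ) {y : Fin 3 → ℝ} (hy : y ∈ Cube3) :
    0 ≤ y 2 ^ 2 * y 0 * gapF κ β₀ β₁ γ₁ γ₂ α (vΨ y) := by
  obtain ⟨h0, h01, h1, h11, h2, h21⟩ := hy
  obtain ⟨ht2, ht21, ht10, ht0⟩ := (mem_simplex_three_iff _).1 (vΨ_mem ⟨h0, h01, h1, h11, h2, h21⟩)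
  have : 0 ≤ gapF κ β₀ β₁ γ₁ γ₂ α (vΨ y) := by
    unfold gapF
    have a1 : 0 < vΨ y 1 := ht2.trans ht21
    have a0 : 0 < vΨ y 0 := a1.trans ht10
    have b0 : 0 < 1 - vΨ y 0 := by linarith
    have b1 : 0 < vΨ y 0 - vΨ y 1 := by linarith
    have b2 : 0 < vΨ y 1 - vΨ y 2 := by linarith
    have b3 : 0 < 1 - vΨ y 1 := by linarith
    have b4 : 0 < 1 - vΨ y 2 := by linarith
    have b5 : 0 < vΨ y 0 - vΨ y 2 := by linarith
    positivity
  positivity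

/-! ### 26d  Collecting powers of one base -/

/-- Auxiliary step `collect2`. [bookkeeping] -/
theorem collect2 {x : ℝ} (hx : 0 < x) (n : ℕ) (p q : ℝ) :
    x ^ n * x ^ (-p) * x ^ (-q) = x ^ ((n : ℝ) - p - q) := by
  rw [sub_eq_add_neg, sub_eq_add_neg, ← Real.rpow_natCast, ← Real.rpow_add hx, ← Real.rpow_add hx]

/-- Auxiliary step `collect3`. [bookkeeping] -/
theorem collect3 {x : ℝ} (hx : 0 < x) (n : ℕ) (p q r : ℝ) :
    x ^ n * x ^ (-p) * x ^ (-q) * x ^ (-r) = x ^ ((n : ℝ) - p - q - r) := by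
  rw [sub_eq_add_neg, sub_eq_add_neg, sub_eq_add_neg, ← Real.rpow_natCast, ← Real.rpow_add hx, ← Real.rpow_add hx,
    ← Real.rpow_add hx]

/-- the far-corner part routed: `gapW ≤ ∏ (1-yᵢ)^{Aᵢ}` with `A = (κ₁-a-b'-c', κ₂-a'-c'', κ₀-b-c)` -/
theorem gapW_le (κ : Fin 4 → ℕ) (γ₁ γ₂ α : ℕ) {a a' b b' c c' c'' : ℝ} (ha : 0 ≤ a) (ha' : 0 ≤ a') (hb : 0 ≤ b)
    (hb' : 0 ≤ b') (hc : 0 ≤ c) (hc' : 0 ≤ c') (hc'' : 0 ≤ c'') (hα : a + a' = α) (hγ₁ : b + b' = γ₁)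
    (hγ₂ : c + c' + c'' = γ₂) {y : Fin 3 → ℝ} (hy : y ∈ Cube3) :
    gapW κ γ₁ γ₂ α y ≤
      ∏ i, (1 - y i) ^ (![(κ 1 : ℝ) - a - b' - c', (κ 2 : ℝ) - a' - c'', (κ 0 : ℝ) - b - c] : Fin 3 → ℝ) i := by
  obtain ⟨h0, h01, h1, h11, h2, h21⟩ := hy
  obtain ⟨u0, u1, u2, p01, p20, p201⟩ := cube_facts ⟨h0, h01, h1, h11, h2, h21⟩
  have Bα : 1 / (1 - y 0 * y 1) ^ α ≤ (1 - y 0) ^ (-a) * (1 - y 1) ^ (-a') :=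
    one_div_pow_le_rpow2 h0.le h01 h1.le h11 ha ha' hα
  have Bγ₁ : 1 / (1 - y 2 * y 0) ^ γ₁ ≤ (1 - y 2) ^ (-b) * (1 - y 0) ^ (-b') :=
    one_div_pow_le_rpow2 h2.le h21 h0.le h01 hb hb' hγ₁
  have Bγ₂ : 1 / (1 - y 2 * y 0 * y 1) ^ γ₂ ≤ (1 - y 2) ^ (-c) * (1 - y 0) ^ (-c') * (1 - y 1) ^ (-c'') :=
    one_div_pow_le_rpow3 h2.le h21 h0.le h01 h1.le h11 hc hc' hc'' hγ₂
  have N0 : 0 ≤ (1 - y 2) ^ κ 0 * (1 - y 0) ^ κ 1 * (1 - y 1) ^ κ 2 := by positivity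
  have hy1 : y 1 ^ κ 3 ≤ 1 := pow_le_one₀ h1.le h11.le
  have step1 : gapW κ γ₁ γ₂ α y ≤ ((1 - y 2) ^ κ 0 * (1 - y 0) ^ κ 1 * (1 - y 1) ^ κ 2) *
      (1 / (1 - y 0 * y 1) ^ α) * (1 / (1 - y 2 * y 0) ^ γ₁) * (1 / (1 - y 2 * y 0 * y 1) ^ γ₂) := by
    unfold gapW
    rw [show y 1 ^ κ 3 * ((1 - y 2) ^ κ 0 * (1 - y 0) ^ κ 1 * (1 - y 1) ^ κ 2) /
        ((1 - y 0 * y 1) ^ α * (1 - y 2 * y 0) ^ γ₁ * (1 - y 2 * y 0 * y 1) ^ γ₂) =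
        y 1 ^ κ 3 * (((1 - y 2) ^ κ 0 * (1 - y 0) ^ κ 1 * (1 - y 1) ^ κ 2) *
      (1 / (1 - y 0 * y 1) ^ α) * (1 / (1 - y 2 * y 0) ^ γ₁) * (1 / (1 - y 2 * y 0 * y 1) ^ γ₂)) by
        field_simp]
    exact mul_le_of_le_one_left (by positivity) hy1
  refine step1.trans ?_
  calc ((1 - y 2) ^ κ 0 * (1 - y 0) ^ κ 1 * (1 - y 1) ^ κ 2) *
      (1 / (1 - y 0 * y 1) ^ α) * (1 / (1 - y 2 * y 0) ^ γ₁) * (1 / (1 - y 2 * y 0 * y 1) ^ γ₂)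
        ≤ ((1 - y 2) ^ κ 0 * (1 - y 0) ^ κ 1 * (1 - y 1) ^ κ 2) *
      ((1 - y 0) ^ (-a) * (1 - y 1) ^ (-a')) * ((1 - y 2) ^ (-b) * (1 - y 0) ^ (-b')) *
      ((1 - y 2) ^ (-c) * (1 - y 0) ^ (-c') * (1 - y 1) ^ (-c'')) := by gcongr
    _ = ((1 - y 0) ^ κ 1 * (1 - y 0) ^ (-a) * (1 - y 0) ^ (-b') * (1 - y 0) ^ (-c')) *
      ((1 - y 1) ^ κ 2 * (1 - y 1) ^ (-a') * (1 - y 1) ^ (-c'')) *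
      ((1 - y 2) ^ κ 0 * (1 - y 2) ^ (-b) * (1 - y 2) ^ (-c)) := by ring
    _ = ∏ i, (1 - y i) ^ (![(κ 1 : ℝ) - a - b' - c', (κ 2 : ℝ) - a' - c'', (κ 0 : ℝ) - b - c] : Fin 3 → ℝ) i := by
        rw [collect3 u0, collect2 u1, collect2 u2, prod_three_rpow]
        simp only [Matrix.cons_val_zero, Matrix.cons_val_one, Matrix.head_cons, Matrix.cons_val_two, Matrix.tail_cons]

/-! ### 26e  The theorem -/

/-- Auxiliary step `continuous_vΨ`. [bookkeeping] -/
theorem continuous_vΨ : Continuous vΨ := by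
  refine continuous_pi fun i => ?_
  fin_cases i <;> simp [vΨ] <;> fun_prop

/-- Auxiliary step `gapDen_pos`. [bookkeeping] -/
theorem gapDen_pos (κ : Fin 4 → ℕ) {t : Fin 3 → ℝ} (ht : t ∈ KZ.openOrderedSimplex 3) :
    0 < (1 - t 0) ^ κ 0 * (t 0 - t 1) ^ κ 1 * (t 1 - t 2) ^ κ 2 * t 2 ^ κ 3 := by
  obtain ⟨h2, h21, h10, h0'⟩ := (mem_simplex_three_iff t).1 ht
  have a : 0 < 1 - t 0 := by linarith
  have b : 0 < t 0 - t 1 := by linarith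
  have c : 0 < t 1 - t 2 := by linarith
  positivity

/-- Auxiliary step `continuousOn_gapF`. [bookkeeping] -/
theorem continuousOn_gapF (κ : Fin 4 → ℕ) (β₀ β₁ γ₁ γ₂ α : ℕ) :
    ContinuousOn (gapF κ β₀ β₁ γ₁ γ₂ α) (KZ.openOrderedSimplex 3) :=
  (Continuous.continuousOn (by fun_prop)).div (Continuous.continuousOn (by fun_prop))
    fun _ ht => (layerDen_pos ht β₀ β₁ γ₁ γ₂ α).ne'

/-- **THE CONVERGENCE ENGINE** (sector criterion, sufficiency): under the five order conditions of §23/§24 the gap class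
`g^κ/((123)^β₀ (23)^β₁ (01)^γ₁ (012)^γ₂ (12)^α)` is absolutely integrable on `Δ₃`. -/
theorem gapClass_integrableOn (κ : Fin 4 → ℕ) {β₀ β₁ γ₁ γ₂ α : ℕ} (hV0 : β₀ + β₁ + α ≤ κ 1 + κ 2 + κ 3 + 2)
    (hE1 : β₁ ≤ κ 2 + κ 3 + 1) (hEd : α ≤ κ 1 + κ 2 + 1) (hE2 : γ₁ ≤ κ 0 + κ 1 + 1)
    (hV1 : γ₂ + γ₁ + α ≤ κ 0 + κ 1 + κ 2 + 2) :
    IntegrableOn (gapF κ β₀ β₁ γ₁ γ₂ α) (KZ.openOrderedSimplex 3) := by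
  obtain ⟨a, a', b, b', c, c', c'', ha, ha', hb, hb', hc, hc', hc'', hα, hγ₁, hγ₂, L0, L1, L2⟩ :=
    routing3 (κ 0) (κ 1) (κ 2) α γ₁ γ₂ hEd hE2 hV1
  set A : Fin 3 → ℝ := ![(κ 1 : ℝ) - a - b' - c', (κ 2 : ℝ) - a' - c'', (κ 0 : ℝ) - b - c] with hA_def
  have hA : ∀ i, -1 < A i := by
    intro i
    fin_cases i
    · show -1 < (κ 1 : ℝ) - a - b' - c'
      linarith
    · show -1 < (κ 2 : ℝ) - a' - c''
      linarith
    · show -1 < (κ 0 : ℝ) - b - c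
      linarith
  have hG : ContinuousOn (fun y => y 2 ^ 2 * y 0 * gapF κ β₀ β₁ γ₁ γ₂ α (vΨ y)) Cube3 := by
    refine (Continuous.continuousOn (by fun_prop)).mul
      ((continuousOn_gapF κ β₀ β₁ γ₁ γ₂ α).comp continuous_vΨ.continuousOn fun y hy => vΨ_mem hy)
  refine integrableOn_of_vchart (integrableOn_cube_of_le hG A hA fun y hy => ?_)
  rw [abs_of_nonneg (gapF_chart_nonneg κ β₀ β₁ γ₁ γ₂ α hy)]
  exact (gapF_chart_le κ hV0 hE1 hy).trans (gapW_le κ γ₁ γ₂ α ha ha' hb hb' hc hc' hc'' hα hγ₁ hγ₂ hy)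

/-- the gap class is `ℚ`-semialgebraic on `Δ₃` -/
theorem gapF_sa (κ : Fin 4 → ℕ) (β₀ β₁ γ₁ γ₂ α : ℕ) :
    IsSemialgebraicFunOn ℚ (KZ.openOrderedSimplex 3) (gapF κ β₀ β₁ γ₁ γ₂ α) := by
  refine (isSemialgebraicFunOn_aeval_div_aeval (KZ.isSemialgebraic_openOrderedSimplex 3)
    ((MvPolynomial.C 1 - MvPolynomial.X 0) ^ κ 0 * (MvPolynomial.X 0 - MvPolynomial.X 1) ^ κ 1 *
      (MvPolynomial.X 1 - MvPolynomial.X 2) ^ κ 2 * MvPolynomial.X 2 ^ κ 3)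
    (MvPolynomial.X 0 ^ β₀ * MvPolynomial.X 1 ^ β₁ * (MvPolynomial.C 1 - MvPolynomial.X 1) ^ γ₁ *
      (MvPolynomial.C 1 - MvPolynomial.X 2) ^ γ₂ * (MvPolynomial.X 0 - MvPolynomial.X 2) ^ α) fun t ht => ?_).congr
    fun t ht => ?_
  · simp only [map_mul, map_pow, map_sub, MvPolynomial.aeval_X, map_one]
    exact (layerDen_pos ht β₀ β₁ γ₁ γ₂ α).ne'
  · simp only [map_mul, map_pow, map_sub, MvPolynomial.aeval_X, map_one, gapF]

/-- **the GAP-CLASS REPRESENTATION**: an admissible gap class as an honest `KZ.IntegralRep 3` on `Δ₃` -/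
def gapRep (κ : Fin 4 → ℕ) {β₀ β₁ γ₁ γ₂ α : ℕ} (hV0 : β₀ + β₁ + α ≤ κ 1 + κ 2 + κ 3 + 2)
    (hE1 : β₁ ≤ κ 2 + κ 3 + 1) (hEd : α ≤ κ 1 + κ 2 + 1) (hE2 : γ₁ ≤ κ 0 + κ 1 + 1)
    (hV1 : γ₂ + γ₁ + α ≤ κ 0 + κ 1 + κ 2 + 2) : KZ.IntegralRep 3 :=
  ⟨KZ.openOrderedSimplex 3, gapF κ β₀ β₁ γ₁ γ₂ α, KZ.isSemialgebraic_openOrderedSimplex 3, gapF_sa κ β₀ β₁ γ₁ γ₂ α,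
    gapClass_integrableOn κ hV0 hE1 hEd hE2 hV1⟩

/-- Auxiliary step `gapRep_domain`. [bookkeeping] -/
theorem gapRep_domain (κ : Fin 4 → ℕ) {β₀ β₁ γ₁ γ₂ α : ℕ} (hV0 : β₀ + β₁ + α ≤ κ 1 + κ 2 + κ 3 + 2)
    (hE1 : β₁ ≤ κ 2 + κ 3 + 1) (hEd : α ≤ κ 1 + κ 2 + 1) (hE2 : γ₁ ≤ κ 0 + κ 1 + 1)
    (hV1 : γ₂ + γ₁ + α ≤ κ 0 + κ 1 + κ 2 + 2) : (gapRep κ hV0 hE1 hEd hE2 hV1).domain = KZ.openOrderedSimplex 3 := rfl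

/-- Auxiliary step `gapRep_integrand`. [bookkeeping] -/
theorem gapRep_integrand (κ : Fin 4 → ℕ) {β₀ β₁ γ₁ γ₂ α : ℕ} (hV0 : β₀ + β₁ + α ≤ κ 1 + κ 2 + κ 3 + 2)
    (hE1 : β₁ ≤ κ 2 + κ 3 + 1) (hEd : α ≤ κ 1 + κ 2 + 1) (hE2 : γ₁ ≤ κ 0 + κ 1 + 1)
    (hV1 : γ₂ + γ₁ + α ≤ κ 0 + κ 1 + κ 2 + 2) : (gapRep κ hV0 hE1 hEd hE2 hV1).integrand = gapF κ β₀ β₁ γ₁ γ₂ α := rfl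

end LayerConv

/-! ## Axiom audit (gen 11 third addendum, §25–§26): the convergence engines — a deviation is an ERROR. -/

end Summit.KontsevichZagierPeriods.RootDecompZetaThreeFrontier.WordLayer

/-! ## §25f  BY NAME for the registered skeleton «gz_ladder» on 32433: layer classes EXIST as honest reps
(the local defs `simplex` / `IsLayerThree` / `layerThree` are reproduced VERBATIM from the skeleton). -/

namespace Summit.KontsevichZagierPeriods.KontsevichZagierPeriods.Cruxes.GZNormalFormWThree.GZLadder

open Summit.KontsevichZagierPeriods.RootDecompZetaThreeFrontier

end Summit.KontsevichZagierPeriods.KontsevichZagierPeriods.Cruxes.GZNormalFormWThree.GZLadder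
end
end
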